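import Summits.QuantumFields.BalabanUV.T4Continuum.Support.NE7SliceCoarseDatumLetter
import Summits.QuantumFields.BalabanUV.T4Continuum.Support.NE7RelIterCornerForm
import HarnessLib

/-!
# NE7SliceCoarseDatumStraight — THE COARSE DATUM OF AN (S1) STATE IS THE LINEARISED AVERAGE OF ITS STRAIGHT COPY, AND THE STRAIGHT GAUGE COPY HAS
# VANISHING RELATIVE COORDINATE (memo ROAD-G102 §9 STEP 1, §10)

Cell `pub-balaban`, lineage `t4-ne7-p1` (CRUX PROVER NE7 #1, owner of BINDER row NE7), gen 102; sequel of `NE7SliceCoarseDatumLetter` (which reads the coarse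
datum as a DIFFERENCE of two quadratic remainders, `φ(u) = R₂(h(u)) − Q₂(X(u))`, two terms that are separately as large as the square of the accumulated corner
charges and cancel — the numerics E2∕E3 of the memo) and of `NE7RelIterCornerForm` (k-fold corner form, unshifted-fibre fixed point).  HERE the cancellation is
performed EXACTLY: pick ANY fine skew periodic gauge field `Λ` READING THE CORNER LOGS, `Λ(M•z) = h(u)(z)` (`M = L^{k+1}`), and split the chart additively,
`X(u) = gaugeDir W Λ + R`, `R := X(u) − gaugeDir W Λ` (written out as a lambda; no new definition).  Then
 (1) `φ(u) = dirIter L (k+1) W R` EXACTLY (`coarseDatum_eq_dirIter_straight`; gauge directions push to gauge directions, `NE3TangentCovariantTower.dirIter_add_gaugeDir`);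
 (2) on the (S1) fibre (`NE7SliceCoarseDatumLetter.cavgIter_state_eq_gaugeAct`) the straight GAUGE copy `R′ := gaugeExtract W Λ R` (so that `W·e^{X(u)} = (W·e^{R′})^{e^{Λ}}`)
     has `relIter L (k+1) W R′ = 0` (`relIter_straightCopy_eq_zero`), hence
 (3) `φ(u) = −[relIter − dirIter] R′ − dirIter (R′ − R)` (`coarseDatum_eq_neg_quadRem_sub`): the coarse datum is MINUS the quadratic remainder of ONE near-tangent
     field plus the linearised average of the extraction defect `R′ − R` (second order, ends form `BlockAverageGaugeExtractCfg.norm_gaugeExtract_sub_le_ends`) —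
     no corner-charge term, nothing to cancel.  This is the form in which (S2) = hDL′ of `NE7HintOfDirectLettersSU2FM` is to be attacked (memo §10).
-/

set_option autoImplicit false

open scoped BigOperators Matrix.Norms.L2Operator
open NormedSpace Finset

namespace Summit.QuantumFields.BalabanUV.T4Continuum.NE7SliceCoarseDatumStraight

open Literature.MathematicalPhysics.QuantumFieldTheory.Balaban1983to89
open B7Prop1Explicit B7Prop2Explicit MatrixLog
open T4AveragingDeficitWall (IsUnitaryCfg IsSkewDir SmallField vary Ad)
open T4AveragingDeficitWallBoundary (IsPeriodicCfg)
open AveragingDeficitPeriodicCounting (IsPeriodicDir)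
open AveragingDeficitMultiLevelPrep (cavgIter LevelSmall tower)
open BlockAveragePushDirGauge (gaugeDir expGauge)
open BlockAverageGaugeExtract (gaugeExtract)
open BlockAverageVaryDisc (rho0)
open NE3EnergyShapes (IsUnitarySite IsPeriodicSite)
open NE3TangentCovariantTower (dirIter dirIter_add dirIter_add_gaugeDir)
open NE3LinearisedAverageSup (curvSum)
open NE3QuadRemainderTower (relIter)
open NE3FramePotBoundW (tower_eq_pow_mul levelSmall_pred)
open NE7SliceIterationState (repLog cornerLog coarseDatum)
open NE7SliceIterationStateFacts (repLog_skew repLog_periodic)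
open NE7SliceCoarseDatumLetter (cavgIter_state_eq_gaugeAct)
open NE7RelIterCornerForm (relIter_gaugeExtract_eq_zero_of_fibre)

noncomputable section

variable {d : ℕ} {n : Type*} [Fintype n] [DecidableEq n] [Nonempty n]

section State

variable {L : ℕ} (hL : 2 ≤ L) (k : ℕ) {W : Site d → Fin d → (Matrix n n ℂ)ˣ} {x : ℝ} (hWu : IsUnitaryCfg W) (hx : 0 ≤ x) (hsK : LevelSmall d L (k + 1) x)
  (hWx : SmallField W x) (N : ℕ) [NeZero N] (U' : Site d → Fin d → (Matrix n n ℂ)ˣ)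
  (hWP : IsPeriodicCfg W ((tower L N (k + 1) : ℕ) : ℤ)) (hU'u : IsUnitaryCfg U') (hU'P : IsPeriodicCfg U' ((tower L N (k + 1) : ℕ) : ℤ))
  (hA : curvSum d L (k + 1) x ≤ 2 / 3 * L)
  {x' : ℝ} (hx'0 : 0 ≤ x') (hs' : LevelSmall d L k x') (hU'x : SmallField U' x')
  (htop : cavgIter L (k + 1) U' = cavgIter L (k + 1) W)
  {u : Site d → (Matrix n n ℂ)ˣ} (hu : IsUnitarySite u) (huP : IsPeriodicSite u ((tower L N (k + 1) : ℕ) : ℤ))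
  (hgauge : gaugeAct u U' = vary W (repLog W U' u) 1) (hX8 : ∀ y κ, ‖repLog W U' u y κ‖ ≤ 1 / 8)
  (hcorner : ∀ z, ((u (((L : ℤ) ^ (k + 1)) • z) : (Matrix n n ℂ)ˣ) : Matrix n n ℂ) = exp (cornerLog L k u z))
  -- the fine gauge field reading the corner logs
  {Λ : Site d → Matrix n n ℂ} (hΛ : ∀ y, Λ y ∈ skewAdjoint (Matrix n n ℂ))
  (hΛP : ∀ (y : Site d) (i : Fin d), Λ (y + ((tower L N (k + 1) : ℕ) : ℤ) • e i) = Λ y)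
  (hread : ∀ z, Λ (((L : ℤ) ^ (k + 1)) • z) = cornerLog L k u z)

include hL hWu hx hsK hWx hWP hΛ hΛP hread in
/-- **(1) THE COARSE DATUM IS THE LINEARISED AVERAGE OF THE STRAIGHT COPY**: `φ(u) = dirIter L (k+1) W R`, `R = X(u) − gaugeDir W Λ`, for any skew periodic `Λ`
with `Λ(M•z) = h(u)(z)` — the gauge direction of `Λ` pushes to the gauge direction of `Λ∘(M•) = h(u)` (`dirIter_add_gaugeDir`), which is what `φ` subtracts. [folklore] -/
theorem coarseDatum_eq_dirIter_straight (z : Site d) (κ : Fin d) :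
    coarseDatum L k W U' u z κ = dirIter L (k + 1) W (fun y μ => repLog W U' u y μ - gaugeDir W Λ y μ) z κ := by
  have hL1 : 1 ≤ L := by omega
  have hsplit : repLog W U' u = fun y ν => (repLog W U' u y ν - gaugeDir W Λ y ν) + gaugeDir W Λ y ν := by
    funext y ν; simp
  have hpush := dirIter_add_gaugeDir (M := N) hL1 k hWu hWP hx (levelSmall_pred k hsK) hWx (fun y μ => repLog W U' u y μ - gaugeDir W Λ y μ) hΛ hΛP
  have hh : (fun y => Λ (((L : ℤ) ^ (k + 1)) • y)) = cornerLog L k u := funext hread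
  simp only [coarseDatum]
  rw [hsplit, hpush, hh]
  simp

include hL hU'u hx'0 hs' hU'x htop hu hgauge hcorner hread in
/-- **THE (S1) FIBRE IN CORNER-READING FORM**: `cavgIter(W·e^{gaugeDir W Λ + R}) = (cavgIter W)^{e^{Λ(M•)}}`. [folklore] -/
theorem fibre_read :
    cavgIter L (k + 1) (vary W (gaugeDir W Λ + (fun y μ => repLog W U' u y μ - gaugeDir W Λ y μ)) 1)
      = gaugeAct (fun w => expGauge Λ 1 (((L : ℤ) ^ (k + 1)) • w)) (cavgIter L (k + 1) W) := by
  have hsum : (gaugeDir W Λ + fun y μ => repLog W U' u y μ - gaugeDir W Λ y μ) = repLog W U' u := by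
    funext y μ; simp
  rw [hsum, cavgIter_state_eq_gaugeAct hL k U' hU'u hx'0 hs' hU'x htop hu hgauge hcorner]
  congr 1
  funext w
  apply Units.ext
  simp only [expGauge, val_expUnit, Complex.ofReal_one, one_smul, hread]

variable (hΛs : ∀ y, ‖Λ y‖ < 1 / 64) (hRs : ∀ y μ, ‖(repLog W U' u y μ - gaugeDir W Λ y μ)‖ < 1 / 64)
  {r : ℝ} (hr : ∀ (y : Site d) (μ : Fin d), ‖gaugeExtract W Λ (fun y μ => repLog W U' u y μ - gaugeDir W Λ y μ) y μ‖ ≤ r) (hr1 : r ≤ 1)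
  (hσr : 4 * (3 + 12 * (d : ℝ)) ^ 2 * (L : ℝ) ^ (k + 1) * r ≤ rho0 d L ^ 2) (hsmU : LevelSmall d L k (x + 8 * r))

include hL hWu hx hsK hWx hWP hU'u hU'P hA hx'0 hs' hU'x htop hu huP hgauge hX8 hcorner hΛ hΛP hread hΛs hRs hr hr1 hσr hsmU in
/-- **(2) THE STRAIGHT GAUGE COPY HAS VANISHING RELATIVE COORDINATE**: with `R′ := gaugeExtract W Λ R` (so `W·e^{X(u)} = (W·e^{R′})^{e^{Λ}}`), charges and `R` below
`1∕64`, `sup ‖R′‖ ≤ r ≤ 1` on the σ-line and the enlarged class `LevelSmall d L k (x + 8r)`: `relIter L (k+1) W R′ = 0` — the k-fold average of `W·e^{R′}` is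
`cavgIter W` itself (`NE7RelIterCornerForm.relIter_gaugeExtract_eq_zero_of_fibre` on the fibre `fibre_read`). [folklore] -/
theorem relIter_straightCopy_eq_zero (z : Site d) (κ : Fin d) :
    relIter L (k + 1) W (gaugeExtract W Λ (fun y μ => repLog W U' u y μ - gaugeDir W Λ y μ)) z κ = 0 := by
  have hWP' : IsPeriodicCfg W ((L ^ (k + 1) * N : ℕ) : ℤ) := by rw [← tower_eq_pow_mul]; exact hWP
  have hΛP' : ∀ (y : Site d) (i : Fin d), Λ (y + ((L ^ (k + 1) * N : ℕ) : ℤ) • e i) = Λ y := by rw [← tower_eq_pow_mul]; exact hΛP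
  have hXsk := repLog_skew hWu U' hU'u hu hgauge hX8
  have hRsk : IsSkewDir (fun y μ => repLog W U' u y μ - gaugeDir W Λ y μ) := fun y μ =>
    (skewAdjoint (Matrix n n ℂ)).sub_mem (hXsk y μ)
      ((skewAdjoint (Matrix n n ℂ)).sub_mem
        (AveragingDeficitTransport.Ad_mem_skewAdjoint ((unitaryUnits (Matrix n n ℂ)).inv_mem (hWu y μ)) (hΛ y)) (hΛ (y + e μ)))
  have hRP : IsPeriodicDir (fun y μ => repLog W U' u y μ - gaugeDir W Λ y μ) ((L ^ (k + 1) * N : ℕ) : ℤ) := by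
    intro y i μ
    have hX := repLog_periodic k N U' hWP hU'P huP y i μ
    have hG := BlockAveragePushDirGauge.isPeriodicDir_gaugeDir hWP hΛP y i μ
    rw [tower_eq_pow_mul] at hX hG
    simp only [hX, hG]
  exact relIter_gaugeExtract_eq_zero_of_fibre (N := N) hL hWu hWP' hx hsK hWx hA hΛ hΛs hΛP' hRsk hRs hRP hr hr1 hσr hsmU
    (fibre_read hL k U' hU'u hx'0 hs' hU'x htop hu hgauge hcorner hread) z κ

include hL hWu hx hsK hWx hWP hU'u hU'P hA hx'0 hs' hU'x htop hu huP hgauge hX8 hcorner hΛ hΛP hread hΛs hRs hr hr1 hσr hsmU in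
/-- **(3) THE COARSE DATUM WITHOUT CORNER TERMS**: `φ(u)(z,κ) = −[relIter − dirIter] R′ (z,κ) − dirIter (R′ − R) (z,κ)` — minus the quadratic remainder of the
near-tangent straight gauge copy `R′`, minus the linearised average of the extraction defect `R′ − R`; nothing cancels against anything. [folklore] -/
theorem coarseDatum_eq_neg_quadRem_sub (z : Site d) (κ : Fin d) :
    coarseDatum L k W U' u z κ
      = -(relIter L (k + 1) W (gaugeExtract W Λ (fun y μ => repLog W U' u y μ - gaugeDir W Λ y μ)) z κ
            - dirIter L (k + 1) W (gaugeExtract W Λ (fun y μ => repLog W U' u y μ - gaugeDir W Λ y μ)) z κ)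
        - dirIter L (k + 1) W (fun y μ => gaugeExtract W Λ (fun y μ => repLog W U' u y μ - gaugeDir W Λ y μ) y μ - (repLog W U' u y μ - gaugeDir W Λ y μ)) z κ := by
  have hL1 : 1 ≤ L := by omega
  rw [coarseDatum_eq_dirIter_straight hL k hWu hx hsK hWx N U' hWP hΛ hΛP hread z κ,
    relIter_straightCopy_eq_zero hL k hWu hx hsK hWx N U' hWP hU'u hU'P hA hx'0 hs' hU'x htop hu huP hgauge hX8 hcorner hΛ hΛP hread hΛs hRs hr
      hr1 hσr hsmU z κ]
  -- linearity of the k-fold linearised average: `dirIter R′ = dirIter R + dirIter (R′ − R)`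
  have hsplit : gaugeExtract W Λ (fun y μ => repLog W U' u y μ - gaugeDir W Λ y μ)
      = fun y μ => (repLog W U' u y μ - gaugeDir W Λ y μ) + (gaugeExtract W Λ (fun y μ => repLog W U' u y μ - gaugeDir W Λ y μ) y μ - (repLog W U' u y μ - gaugeDir W Λ y μ)) := by
    funext y μ; abel
  have hadd := dirIter_add hL1 k hWu hx (levelSmall_pred k hsK) hWx (fun y μ => repLog W U' u y μ - gaugeDir W Λ y μ)
    (fun y μ => gaugeExtract W Λ (fun y μ => repLog W U' u y μ - gaugeDir W Λ y μ) y μ - (repLog W U' u y μ - gaugeDir W Λ y μ))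
  have hb : dirIter L (k + 1) W (gaugeExtract W Λ (fun y μ => repLog W U' u y μ - gaugeDir W Λ y μ)) z κ
      = dirIter L (k + 1) W (fun y μ => repLog W U' u y μ - gaugeDir W Λ y μ) z κ
        + dirIter L (k + 1) W (fun y μ => gaugeExtract W Λ (fun y μ => repLog W U' u y μ - gaugeDir W Λ y μ) y μ - (repLog W U' u y μ - gaugeDir W Λ y μ)) z κ := by
    conv_lhs => rw [hsplit]
    exact congrFun (congrFun hadd z) κ
  rw [hb]; abel

end State

end

end Summit.QuantumFields.BalabanUV.T4Continuum.NE7SliceCoarseDatumStraight
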